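import Mathlib
import Literature.MathematicalPhysics.StatisticalMechanics.HardCoreCanonical
import Literature.MathematicalPhysics.KineticTheory.HardSphereEulerProofs
import HarnessLib

/-!
# `StaticScoreResponse` (support item stmt-AtomisticToContinuum-12269): complex-tilted polymer
# activities of the canonical hard-core gas

For the canonical hard-core gas of independent points (`HardCoreCanonical`: labels `ι`, common law
`ν`, overlap `O`, Ursell weights `u_B = uR O · B`) and a bounded one-body observable `G` (`|G| ≤ 1`)
we study the **complex-tilted polymer activities**

`ζ_s(B) = (∫ u_B(x) exp(s ∑_{i ∈ B} G(x_i)) dν^{⊗ι}(x)) / m(s)^{|B|}`, `m(s) = ∫ exp(s G) dν`,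

for a complex parameter `s`:

* `m` and the numerators are holomorphic in `s` on the unit disc (differentiation under the
  integral sign), `‖m(s) - 1‖ ≤ 1/2` for `‖s‖ ≤ 1/4`, so `ζ_·(B)` is holomorphic on the disc
  `‖s‖ < 1/4` (`differentiableOn_tiltedActivity`);
* the tree bound `‖ζ_s(B)‖ ≤ (2 e^{1/4})^{|B|} t(|B|) p^{|B| - 1}` for `‖s‖ < 1/4`, uniformly in `s`,
  whenever `ν`-balls of the overlap relation have mass `≤ p` (`norm_tiltedActivity_le`);
* for REAL `s`, `ζ_s(B)` is the integrated Ursell weight `∫ u_B dν_s^{⊗ι}` of the tilted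
  probability measure `ν_s = (e^{sG}/m(s)) ν` (`tiltedActivity_ofReal`), in particular real.

Together with the polymer representation of the hard-core probability and the Kotecký–Preiss
logarithm this yields a holomorphic, uniformly bounded extension of
`s ↦ log ℙ_{ν_s}(no overlap)`, whence Cauchy bounds on the cumulants of `∑ G(x_i)` under the
canonical hard-core Gibbs measure, uniformly in the number of particles. Folklore; no definitions,
no named facts.
-/

noncomputable section

namespace Summit.AtomisticToContinuum.HydrodynamicLimit.Theorems

open Finset MeasureTheory Complex Metric Literature.Probability.LatticeModels
  Literature.MathematicalPhysics.StatisticalMechanics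

variable {ι : Type*} [Fintype ι] [DecidableEq ι] {X : Type*} [MeasurableSpace X]
  {O : X → X → Prop} (ν : Measure X) [IsProbabilityMeasure ν] {G : X → ℝ}

/-! ### The tilting factor `exp (s G)` and its mean `m(s)` -/

omit [MeasurableSpace X] in
/-- `‖exp (s G(y))‖ ≤ exp ‖s‖` for `|G| ≤ 1`. [folklore] -/
theorem norm_cexp_mul_ofReal_le {s : ℂ} (hG : ∀ y, |G y| ≤ 1) (y : X) :
    ‖Complex.exp (s * (G y : ℂ))‖ ≤ Real.exp ‖s‖ := by
  refine (Complex.norm_exp_le_exp_norm _).trans (Real.exp_le_exp.2 ?_)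
  rw [norm_mul, Complex.norm_real, Real.norm_eq_abs]
  nlinarith [norm_nonneg s, hG y, abs_nonneg (G y)]

omit [MeasurableSpace X] in
/-- `‖exp (s G(y)) - 1‖ ≤ 2‖s‖` for `|G| ≤ 1`, `‖s‖ ≤ 1`. [folklore] -/
theorem norm_cexp_mul_ofReal_sub_one_le {s : ℂ} (hs : ‖s‖ ≤ 1) (hG : ∀ y, |G y| ≤ 1) (y : X) :
    ‖Complex.exp (s * (G y : ℂ)) - 1‖ ≤ 2 * ‖s‖ := by
  have h1 : ‖s * (G y : ℂ)‖ ≤ ‖s‖ := by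
    rw [norm_mul, Complex.norm_real, Real.norm_eq_abs]
    nlinarith [norm_nonneg s, hG y, abs_nonneg (G y)]
  exact (Complex.norm_exp_sub_one_le (h1.trans hs)).trans (by linarith)

/-- Measurability of the tilting factor. [folklore] -/
theorem measurable_cexp_mul_ofReal (hGm : Measurable G) (s : ℂ) :
    Measurable fun y => Complex.exp (s * (G y : ℂ)) :=
  Complex.measurable_exp.comp (measurable_const.mul (Complex.measurable_ofReal.comp hGm))

/-- Integrability of the tilting factor. [folklore] -/
theorem integrable_cexp_mul_ofReal (hGm : Measurable G) (hG : ∀ y, |G y| ≤ 1) (s : ℂ) :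
    Integrable (fun y => Complex.exp (s * (G y : ℂ))) ν :=
  Integrable.mono' (integrable_const (Real.exp ‖s‖)) (measurable_cexp_mul_ofReal hGm s).aestronglyMeasurable
    (ae_of_all _ fun y => norm_cexp_mul_ofReal_le hG y)

/-- `‖m(s) - 1‖ ≤ 2‖s‖` for `‖s‖ ≤ 1`: the mean tilting factor is close to `1`. [folklore] -/
theorem norm_integral_cexp_sub_one_le (hGm : Measurable G) (hG : ∀ y, |G y| ≤ 1) {s : ℂ} (hs : ‖s‖ ≤ 1) :
    ‖(∫ y, Complex.exp (s * (G y : ℂ)) ∂ν) - 1‖ ≤ 2 * ‖s‖ := by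
  have h1 : (∫ y, Complex.exp (s * (G y : ℂ)) ∂ν) - 1 = ∫ y, (Complex.exp (s * (G y : ℂ)) - 1) ∂ν := by
    rw [integral_sub (integrable_cexp_mul_ofReal ν hGm hG s) (integrable_const _)]
    simp
  rw [h1]
  calc ‖∫ y, (Complex.exp (s * (G y : ℂ)) - 1) ∂ν‖ ≤ ∫ y, ‖Complex.exp (s * (G y : ℂ)) - 1‖ ∂ν :=
        norm_integral_le_integral_norm _
    _ ≤ ∫ _y, 2 * ‖s‖ ∂ν := by
        refine integral_mono_of_nonneg (ae_of_all _ fun y => norm_nonneg _) (integrable_const _)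
          (ae_of_all _ fun y => norm_cexp_mul_ofReal_sub_one_le hs hG y)
    _ = 2 * ‖s‖ := by simp

/-- `1/2 ≤ ‖m(s)‖` for `‖s‖ ≤ 1/4`. [folklore] -/
theorem half_le_norm_integral_cexp (hGm : Measurable G) (hG : ∀ y, |G y| ≤ 1) {s : ℂ} (hs : ‖s‖ ≤ 1 / 4) :
    1 / 2 ≤ ‖∫ y, Complex.exp (s * (G y : ℂ)) ∂ν‖ := by
  have h := norm_integral_cexp_sub_one_le ν hGm hG (hs.trans (by norm_num))
  have h2 := norm_sub_norm_le (1 : ℂ) (∫ y, Complex.exp (s * (G y : ℂ)) ∂ν)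
  rw [norm_one, norm_sub_rev] at h2
  linarith

/-- `m(s) ≠ 0` for `‖s‖ ≤ 1/4`. [folklore] -/
theorem integral_cexp_ne_zero (hGm : Measurable G) (hG : ∀ y, |G y| ≤ 1) {s : ℂ} (hs : ‖s‖ ≤ 1 / 4) :
    (∫ y, Complex.exp (s * (G y : ℂ)) ∂ν) ≠ 0 := fun h0 => by
  have h := half_le_norm_integral_cexp ν hGm hG hs
  rw [h0, norm_zero] at h
  norm_num at h

/-- `m` is holomorphic on the unit disc (differentiation under the integral sign). [folklore] -/
theorem differentiableOn_integral_cexp (hGm : Measurable G) (hG : ∀ y, |G y| ≤ 1) :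
    DifferentiableOn ℂ (fun s => ∫ y, Complex.exp (s * (G y : ℂ)) ∂ν) (ball 0 1) := by
  intro s₀ hs₀
  have hball : ball (0 : ℂ) 1 ∈ nhds s₀ := isOpen_ball.mem_nhds hs₀
  have key := hasDerivAt_integral_of_dominated_loc_of_deriv_le (μ := ν) (x₀ := s₀)
    (F := fun s y => Complex.exp (s * (G y : ℂ)))
    (F' := fun s y => (G y : ℂ) * Complex.exp (s * (G y : ℂ))) (bound := fun _ => Real.exp 1)
    hball (Filter.Eventually.of_forall fun s => (measurable_cexp_mul_ofReal hGm s).aestronglyMeasurable)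
    (integrable_cexp_mul_ofReal ν hGm hG s₀)
    (((Complex.measurable_ofReal.comp hGm).mul (measurable_cexp_mul_ofReal hGm s₀)).aestronglyMeasurable)
    (ae_of_all _ fun y s hs => by
      rw [norm_mul, Complex.norm_real, Real.norm_eq_abs]
      have h1 := norm_cexp_mul_ofReal_le (s := s) hG y
      have h2 : Real.exp ‖s‖ ≤ Real.exp 1 := Real.exp_le_exp.2 (le_of_lt (by simpa using hs))
      calc |G y| * ‖Complex.exp (s * (G y : ℂ))‖ ≤ 1 * Real.exp 1 :=
            mul_le_mul (hG y) (h1.trans h2) (norm_nonneg _) zero_le_one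
        _ = Real.exp 1 := one_mul _)
    (integrable_const _)
    (ae_of_all _ fun y s _ => by
      have h := ((hasDerivAt_id s).mul_const (G y : ℂ)).cexp
      simpa [mul_comm] using h)
  exact key.2.differentiableAt.differentiableWithinAt

/-! ### The numerators `∫ u_B exp(s ∑_{i∈B} G(x_i))` -/

omit [Fintype ι] [DecidableEq ι] [MeasurableSpace X] in
/-- `|∑_{i ∈ B} G(x_i)| ≤ |B|` for `|G| ≤ 1`. [folklore] -/
theorem abs_sum_apply_le_card (hG : ∀ y, |G y| ≤ 1) (x : ι → X) (B : Finset ι) :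
    |∑ i ∈ B, G (x i)| ≤ B.card := by
  calc |∑ i ∈ B, G (x i)| ≤ ∑ i ∈ B, |G (x i)| := Finset.abs_sum_le_sum_abs _ _
    _ ≤ ∑ _i ∈ B, (1 : ℝ) := Finset.sum_le_sum fun i _ => hG (x i)
    _ = B.card := by simp

omit [Fintype ι] [DecidableEq ι] [MeasurableSpace X] in
/-- Norm of the block tilting factor: `‖exp(s ∑_{i∈B} G(x_i))‖ ≤ exp(‖s‖ |B|)`. [folklore] -/
theorem norm_cexp_mul_sum_le (hG : ∀ y, |G y| ≤ 1) (s : ℂ) (x : ι → X) (B : Finset ι) :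
    ‖Complex.exp (s * ((∑ i ∈ B, G (x i) : ℝ) : ℂ))‖ ≤ Real.exp (‖s‖ * B.card) := by
  refine (Complex.norm_exp_le_exp_norm _).trans (Real.exp_le_exp.2 ?_)
  rw [norm_mul, Complex.norm_real, Real.norm_eq_abs]
  exact mul_le_mul_of_nonneg_left (abs_sum_apply_le_card hG x B) (norm_nonneg s)

omit [Fintype ι] in
/-- Measurability of the block integrand. [folklore] -/
theorem measurable_uR_mul_cexp (hO : MeasurableSet {p : X × X | O p.1 p.2}) (hGm : Measurable G)
    (s : ℂ) (B : Finset ι) :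
    Measurable fun x : ι → X => (uR O x B : ℂ) * Complex.exp (s * ((∑ i ∈ B, G (x i) : ℝ) : ℂ)) := by
  refine (Complex.measurable_ofReal.comp (measurable_uR hO B)).mul
    (Complex.measurable_exp.comp (measurable_const.mul (Complex.measurable_ofReal.comp ?_)))
  exact Finset.measurable_sum _ fun i _ => hGm.comp (measurable_pi_apply i)

omit [Fintype ι] [MeasurableSpace X] in
/-- Pointwise bound on the block integrand. [folklore] -/
theorem norm_uR_mul_cexp_le (hG : ∀ y, |G y| ≤ 1) (s : ℂ) (x : ι → X) (B : Finset ι) :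
    ‖(uR O x B : ℂ) * Complex.exp (s * ((∑ i ∈ B, G (x i) : ℝ) : ℂ))‖ ≤
      |uR O x B| * Real.exp (‖s‖ * B.card) := by
  rw [norm_mul, Complex.norm_real, Real.norm_eq_abs]
  exact mul_le_mul_of_nonneg_left (norm_cexp_mul_sum_le hG s x B) (abs_nonneg _)

/-- Integrability of the block integrand. [folklore] -/
theorem integrable_uR_mul_cexp (hO : MeasurableSet {p : X × X | O p.1 p.2}) (hGm : Measurable G)
    (hG : ∀ y, |G y| ≤ 1) (s : ℂ) (B : Finset ι) :
    Integrable (fun x : ι → X => (uR O x B : ℂ) * Complex.exp (s * ((∑ i ∈ B, G (x i) : ℝ) : ℂ)))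
      (Measure.pi fun _ : ι => ν) :=
  Integrable.mono' (integrable_const ((hcUrsellBound B : ℝ) * Real.exp (‖s‖ * B.card)))
    (measurable_uR_mul_cexp hO hGm s B).aestronglyMeasurable
    (ae_of_all _ fun x => (norm_uR_mul_cexp_le hG s x B).trans
      (mul_le_mul_of_nonneg_right (abs_uR_le x B) (Real.exp_nonneg _)))

/-- The numerators are holomorphic on the unit disc (differentiation under the integral sign over
the product probability space; the derivative `u_B (∑ G) exp(s ∑ G)` is bounded). [folklore] -/
theorem differentiableOn_integral_uR_mul_cexp (hO : MeasurableSet {p : X × X | O p.1 p.2})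
    (hGm : Measurable G) (hG : ∀ y, |G y| ≤ 1) (B : Finset ι) :
    DifferentiableOn ℂ (fun s => ∫ x, (uR O x B : ℂ) * Complex.exp (s * ((∑ i ∈ B, G (x i) : ℝ) : ℂ))
      ∂Measure.pi (fun _ : ι => ν)) (ball 0 1) := by
  intro s₀ hs₀
  have hball : ball (0 : ℂ) 1 ∈ nhds s₀ := isOpen_ball.mem_nhds hs₀
  have hsm : Measurable fun x : ι → X => ((∑ i ∈ B, G (x i) : ℝ) : ℂ) :=
    Complex.measurable_ofReal.comp (Finset.measurable_sum _ fun i _ => hGm.comp (measurable_pi_apply i))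
  set K : ℝ := (hcUrsellBound B : ℝ) * (B.card * Real.exp (1 * B.card)) with hK
  have key := hasDerivAt_integral_of_dominated_loc_of_deriv_le (μ := Measure.pi fun _ : ι => ν) (x₀ := s₀)
    (F := fun s x => (uR O x B : ℂ) * Complex.exp (s * ((∑ i ∈ B, G (x i) : ℝ) : ℂ)))
    (F' := fun s x => (uR O x B : ℂ) * (((∑ i ∈ B, G (x i) : ℝ) : ℂ) *
      Complex.exp (s * ((∑ i ∈ B, G (x i) : ℝ) : ℂ)))) (bound := fun _ => K)
    hball (Filter.Eventually.of_forall fun s => (measurable_uR_mul_cexp hO hGm s B).aestronglyMeasurable)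
    (integrable_uR_mul_cexp ν hO hGm hG s₀ B)
    (((Complex.measurable_ofReal.comp (measurable_uR hO B)).mul (hsm.mul
      (Complex.measurable_exp.comp (measurable_const.mul hsm)))).aestronglyMeasurable)
    (ae_of_all _ fun x s hs => by
      have hs1 : ‖s‖ ≤ 1 := le_of_lt (by simpa using hs)
      rw [norm_mul, norm_mul, Complex.norm_real, Complex.norm_real, Real.norm_eq_abs, Real.norm_eq_abs]
      have h1 := norm_cexp_mul_sum_le hG s x B
      have h2 : Real.exp (‖s‖ * B.card) ≤ Real.exp (1 * B.card) :=
        Real.exp_le_exp.2 (mul_le_mul_of_nonneg_right hs1 (Nat.cast_nonneg _))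
      have h3 := abs_sum_apply_le_card hG x B
      have h4 := abs_uR_le (O := O) x B
      calc |uR O x B| * (|∑ i ∈ B, G (x i)| * ‖Complex.exp (s * ((∑ i ∈ B, G (x i) : ℝ) : ℂ))‖)
          ≤ (hcUrsellBound B : ℝ) * (B.card * Real.exp (1 * B.card)) := by
            refine mul_le_mul h4 (mul_le_mul h3 (h1.trans h2) (norm_nonneg _) (Nat.cast_nonneg _))
              (by positivity) (Nat.cast_nonneg _)
        _ = K := rfl)
    (integrable_const K)
    (ae_of_all _ fun x s _ => by
      have h := (((hasDerivAt_id s).mul_const ((∑ i ∈ B, G (x i) : ℝ) : ℂ)).cexp).const_mul (uR O x B : ℂ)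
      simpa [mul_comm, mul_left_comm, mul_assoc] using h)
  exact key.2.differentiableAt.differentiableWithinAt

end Summit.AtomisticToContinuum.HydrodynamicLimit.Theorems

end
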